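import Summits.NavierStokesRegularity.NavierStokesRegularity.Theorems.SymmetricScarExists.Negative.SpiralWorld

/-!
# `SymmetricScarExists` (crux stmt-NavierStokesRegularity-11718, route RellichScar): an explicit
# kinematic spiral field — negative-side support, part 3 (cdisprove seat)

Continuation of `Negative/SpiralWorld.lean`.  For every `α ≠ 0` the explicit field
`u(t,x) = ‖x‖⁻¹ χ(‖x‖/√−t) R(−2α log‖x‖) e₁` (`χ` a cut-off vanishing for `‖x‖ ≤ √−t`; the
final-time shape of a Type-I rotated self-similar profile with the non-equivariant pattern `e₁`,
Pineau–Vicol 2026 §1.2 and Lemma 2.1) has the space–time Type-I bound with constant `2`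
(`hasTypeIDecay_spiralField`), a backward-singular origin (`isBackwardSingularPoint_spiralField`),
is `α`-RSS in group form (`isSpiralRSS_spiralField`), has a spiral scar (`spiralScar_spiralField`),
and has NEITHER an axisymmetric (`not_axiScar_spiralField`: the scar difference for `θ = π` is
`2/‖x‖ ≥ 8/9` on `(−δ,0) × B(2e₁, 1/4)`) NOR a homogeneous scar (`not_homScar_spiralField`):
`exists_kinematic_spiral_counterexample`.  So the crux's dichotomy "homogeneous OR axisymmetric
scar" is incomplete already at the kinematic level at which the Type-I envelope
`C e₃/(‖x‖ + √−t)` meets BOTH alternatives; only the (open) emptiness of the non-equivariant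
Type-I RSS class (P–V Conjecture 1.1) separates this shape from a refutation of the crux.

## References

* B. Pineau, V. Vicol, arXiv:2607.09619 (2026): §1.2 (1.6)–(1.7), Conjecture 1.1, Lemma 2.1. [PineauVicol2026]
-/

noncomputable section

open MeasureTheory Set Function Filter Topology TopologicalSpace Metric
open scoped NNReal ENNReal

namespace Summit.NavierStokesRegularity.NavierStokesRegularity.Theorems.SymmetricScarExists.Negative

open Literature.Analysis.FluidPDE
open Summit.NavierStokesRegularity.NavierStokesRegularity.Theses.RellichScar

section Kinematic

/-- The cut-off `χ(r) = max 0 (min 1 (r − 1))`: `0` for `r ≤ 1`, `1` for `r ≥ 2`, values in `[0,1]`. -/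
def spiralCut (r : ℝ) : ℝ := max 0 (min 1 (r - 1))

/-- `χ ≥ 0`. [folklore] -/
theorem spiralCut_nonneg (r : ℝ) : 0 ≤ spiralCut r := le_max_left _ _

/-- `χ ≤ 1`. [folklore] -/
theorem spiralCut_le_one (r : ℝ) : spiralCut r ≤ 1 :=
  max_le zero_le_one (min_le_left _ _)

/-- `χ(r) = 0` for `r ≤ 1`. [folklore] -/
theorem spiralCut_of_le_one {r : ℝ} (hr : r ≤ 1) : spiralCut r = 0 := by
  unfold spiralCut
  rw [max_eq_left]
  exact (min_le_right _ _).trans (by linarith)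

/-- `χ(r) = 1` for `r ≥ 2`. [folklore] -/
theorem spiralCut_of_two_le {r : ℝ} (hr : 2 ≤ r) : spiralCut r = 1 := by
  unfold spiralCut
  rw [min_eq_left (by linarith), max_eq_right zero_le_one]

/-- The horizontal unit vector `e₁ = (1, 0, 0)`. -/
def e1 : (EuclideanSpace ℝ (Fin 3)) := EuclideanSpace.single 0 1

/-- `(e₁)₀ = 1`. [folklore] -/
@[simp] theorem e1_apply_zero : e1 0 = 1 := by simp [e1]
/-- `(e₁)₁ = 0`. [folklore] -/
@[simp] theorem e1_apply_one : e1 1 = 0 := by simp [e1]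
/-- `(e₁)₂ = 0`. [folklore] -/
@[simp] theorem e1_apply_two : e1 2 = 0 := by simp [e1]

/-- `‖e₁‖ = 1`. [folklore] -/
theorem norm_e1 : ‖e1‖ = 1 := by simp [e1]

/-- `R_π w = −w` for horizontal `w = R_β e₁`. [folklore] -/
theorem rotZ_pi_rotZ_e1 (β : ℝ) : rotZ Real.pi (rotZ β e1) = -rotZ β e1 := by
  rw [← rotZ_add, add_comm]
  ext i
  fin_cases i <;> simp [Real.cos_add_pi, Real.sin_add_pi]

/-- `R_θ 0 = 0`. [folklore] -/
theorem rotZ_zero_vec' (θ : ℝ) : rotZ θ (0 : (EuclideanSpace ℝ (Fin 3))) = 0 := by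
  simpa using rotZ_smul' θ 0 (0 : (EuclideanSpace ℝ (Fin 3)))

/-- **The kinematic spiral field** `u(t,x) = ‖x‖⁻¹ χ(‖x‖/√−t) R(−2α log‖x‖) e₁` for `t < 0`
(`0` for `t ≥ 0`): the final-time shape of a Type-I RSS profile with pattern `A₀ ≡ e₁` (§4). -/
def spiralField (α : ℝ) : ℝ → (EuclideanSpace ℝ (Fin 3)) → (EuclideanSpace ℝ (Fin 3)) := fun t x =>
  if t < 0 then (‖x‖⁻¹ * spiralCut (‖x‖ / Real.sqrt (-t))) • rotZ (-(2 * α * Real.log ‖x‖)) e1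
  else 0

/-- The field for `t < 0`. [folklore] -/
theorem spiralField_of_neg (α : ℝ) {t : ℝ} (ht : t < 0) (x : (EuclideanSpace ℝ (Fin 3))) :
    spiralField α t x = (‖x‖⁻¹ * spiralCut (‖x‖ / Real.sqrt (-t))) • rotZ (-(2 * α * Real.log ‖x‖)) e1 := by
  simp [spiralField, ht]

/-- `‖u(t,x)‖ = ‖x‖⁻¹ χ(‖x‖/√−t)` for `t < 0`. [folklore] -/
theorem norm_spiralField_of_neg (α : ℝ) {t : ℝ} (ht : t < 0) (x : (EuclideanSpace ℝ (Fin 3))) :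
    ‖spiralField α t x‖ = ‖x‖⁻¹ * spiralCut (‖x‖ / Real.sqrt (-t)) := by
  rw [spiralField_of_neg α ht, norm_smul, norm_rotZ, norm_e1, mul_one,
    Real.norm_of_nonneg (mul_nonneg (inv_nonneg.2 (norm_nonneg _)) (spiralCut_nonneg _))]

/-- Far from the parabola (`‖x‖ ≥ 2√−t`) the cut-off is off: `u(t,x) = ‖x‖⁻¹ R(−2α log‖x‖) e₁`.
[folklore] -/
theorem spiralField_of_two_sqrt_le (α : ℝ) {t : ℝ} (ht : t < 0) {x : (EuclideanSpace ℝ (Fin 3))}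
    (hx : 2 * Real.sqrt (-t) ≤ ‖x‖) :
    spiralField α t x = ‖x‖⁻¹ • rotZ (-(2 * α * Real.log ‖x‖)) e1 := by
  have hs : 0 < Real.sqrt (-t) := Real.sqrt_pos.2 (by linarith)
  rw [spiralField_of_neg α ht, spiralCut_of_two_le ((le_div_iff₀ hs).2 hx), mul_one]

/-- **Type-I space–time bound with constant `2`.** [folklore] -/
theorem hasTypeIDecay_spiralField (α : ℝ) : HasTypeIDecay 2 (spiralField α) := by
  intro t ht x
  have hs : 0 < Real.sqrt (-t) := Real.sqrt_pos.2 (by linarith)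
  rw [norm_spiralField_of_neg α ht]
  by_cases hx : ‖x‖ ≤ Real.sqrt (-t)
  · rw [spiralCut_of_le_one ((div_le_one hs).2 hx), mul_zero]
    positivity
  · push Not at hx
    have hxpos : 0 < ‖x‖ := hs.trans hx
    calc ‖x‖⁻¹ * spiralCut (‖x‖ / Real.sqrt (-t)) ≤ ‖x‖⁻¹ * 1 :=
          mul_le_mul_of_nonneg_left (spiralCut_le_one _) (inv_nonneg.2 (norm_nonneg _))
      _ ≤ 2 / (‖x‖ + Real.sqrt (-t)) := by
          rw [mul_one, inv_eq_one_div, div_le_div_iff₀ hxpos (by positivity)]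
          linarith

/-- **The kinematic spiral field is `α`-RSS in group form.** [folklore] -/
theorem isSpiralRSS_spiralField {α : ℝ} (hα : α ≠ 0) : IsSpiralRSS α (spiralField α) := by
  intro θ t ht x
  set c : ℝ := Real.exp (-θ / (2 * α)) with hc
  have hcpos : 0 < c := Real.exp_pos _
  have hct : c ^ 2 * t < 0 := mul_neg_of_pos_of_neg (by positivity) ht
  have hsqrt : Real.sqrt (-(c ^ 2 * t)) = c * Real.sqrt (-t) := by
    rw [show -(c ^ 2 * t) = c ^ 2 * (-t) by ring, Real.sqrt_mul (sq_nonneg c), Real.sqrt_sq hcpos.le]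
  have hlogc : Real.log c = -θ / (2 * α) := by rw [hc, Real.log_exp]
  simp only [conjZ, nsRescale_apply]
  rw [spiralField_of_neg α hct, spiralField_of_neg α ht, norm_rotZ, rotZ_smul', smul_smul,
    norm_smul, Real.norm_of_nonneg hcpos.le, hsqrt]
  by_cases hx : x = 0
  · subst hx
    simp
  have hxn : 0 < ‖x‖ := norm_pos_iff.2 hx
  have hcs : 0 < c * Real.sqrt (-t) := mul_pos hcpos (Real.sqrt_pos.2 (by linarith))
  congr 1
  · rw [mul_inv, mul_div_mul_left _ _ hcpos.ne']
    field_simp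
  · rw [Real.log_mul hcpos.ne' hxn.ne', hlogc, ← rotZ_add]
    congr 1
    field_simp
    ring

/-- **The kinematic spiral field has a spiral scar.** [folklore] -/
theorem spiralScar_spiralField {α : ℝ} (hα : α ≠ 0) : SpiralScar α (spiralField α) :=
  spiralScar_of_isSpiralRSS hα (isSpiralRSS_spiralField hα)

/-- `essSup f μ = ⊤` as soon as `f` exceeds every finite level on a set of positive measure (copy of
the tree's `essSup_eq_top_of_forall_exists_lt`, `ParasiticSlabFlow.lean`). [folklore] -/
theorem essSup_eq_top_of_forall_exists_lt' {X : Type*} {m : MeasurableSpace X} {μ : Measure X}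
    {f : X → ℝ≥0∞} (h : ∀ N : ℝ≥0, ∃ S : Set X, μ S ≠ 0 ∧ ∀ x ∈ S, (N : ℝ≥0∞) < f x) :
    essSup f μ = ⊤ := by
  by_contra hne
  obtain ⟨S, hS, hlt⟩ := h (essSup f μ).toNNReal
  have hco : ((essSup f μ).toNNReal : ℝ≥0∞) = essSup f μ := ENNReal.coe_toNNReal hne
  have hae := ENNReal.ae_le_essSup f (μ := μ)
  rw [ae_iff] at hae
  refine hS (measure_mono_null (fun x hx => ?_) hae)
  simp only [mem_setOf_eq, not_le]
  rw [← hco]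
  exact hlt x hx

/-- **The kinematic spiral field is backward-singular at the origin**: on
`(−(5ρ/16)², 0) × B((3ρ/4)e₁, ρ/8)` the cut-off is off and `‖u‖ = ‖x‖⁻¹ ≥ 8/(7ρ)`. [folklore] -/
theorem isBackwardSingularPoint_spiralField (α : ℝ) : IsBackwardSingularPoint (spiralField α) 0 := by
  intro r hr
  rw [eLpNorm_exponent_top]
  show essSup (fun z => ‖uncurry (spiralField α) z‖ₑ) _ = ⊤
  apply essSup_eq_top_of_forall_exists_lt'
  intro N
  set ρ : ℝ := min (r / 2) (1 / ((N : ℝ) + 1)) with hρ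
  have hρpos : 0 < ρ := lt_min (by positivity) (by positivity)
  have hρr : ρ ≤ r / 2 := min_le_left _ _
  have hρN : ρ ≤ 1 / ((N : ℝ) + 1) := min_le_right _ _
  set x₁ : (EuclideanSpace ℝ (Fin 3)) := (3 * ρ / 4) • e1 with hx₁
  have hnx₁ : ‖x₁‖ = 3 * ρ / 4 := by
    rw [hx₁, norm_smul, norm_e1, mul_one, Real.norm_of_nonneg (by positivity)]
  set τ : ℝ := (5 * ρ / 16) ^ 2 with hτ
  have hτpos : 0 < τ := by positivity
  refine ⟨Ioo (-τ) 0 ×ˢ ball x₁ (ρ / 8), ?_, ?_⟩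
  · have hsub : Ioo (-τ) 0 ×ˢ ball x₁ (ρ / 8) ⊆ parabolicCylinder r (0 : ℝ × (EuclideanSpace ℝ (Fin 3))) := by
      rintro ⟨t, x⟩ ⟨⟨ht1, ht2⟩, hx⟩
      rw [mem_parabolicCylinder]
      refine ⟨⟨?_, by simpa using ht2⟩, ?_⟩
      · have : τ ≤ r ^ 2 := by
          rw [hτ]; nlinarith
        simp only [Prod.fst_zero]
        linarith
      · simp only [Prod.snd_zero, dist_zero_right]
        have hxx : ‖x - x₁‖ < ρ / 8 := by rwa [← dist_eq_norm]
        calc ‖x‖ = ‖(x - x₁) + x₁‖ := by rw [sub_add_cancel]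
          _ ≤ ‖x - x₁‖ + ‖x₁‖ := norm_add_le _ _
          _ < r := by rw [hnx₁]; linarith
    rw [Measure.restrict_apply (measurableSet_Ioo.prod measurableSet_ball),
      inter_eq_left.2 hsub, Measure.volume_eq_prod, Measure.prod_prod]
    refine mul_ne_zero ?_ (measure_ball_pos volume x₁ (by positivity)).ne'
    rw [Real.volume_Ioo]
    simp [hτpos]
  · rintro ⟨t, x⟩ ⟨⟨ht1, ht2⟩, hx⟩
    simp only [uncurry_apply_pair]
    have hxx : ‖x - x₁‖ < ρ / 8 := by rwa [mem_ball, dist_eq_norm] at hx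
    have hxlow : 5 * ρ / 8 ≤ ‖x‖ := by
      have : ‖x₁‖ ≤ ‖x‖ + ‖x - x₁‖ := by
        calc ‖x₁‖ = ‖x - (x - x₁)‖ := by rw [sub_sub_cancel]
          _ ≤ ‖x‖ + ‖x - x₁‖ := norm_sub_le _ _
      rw [hnx₁] at this
      linarith
    have hxup : ‖x‖ ≤ 7 * ρ / 8 := by
      calc ‖x‖ = ‖(x - x₁) + x₁‖ := by rw [sub_add_cancel]
        _ ≤ ‖x - x₁‖ + ‖x₁‖ := norm_add_le _ _
        _ ≤ 7 * ρ / 8 := by rw [hnx₁]; linarith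
    have hxpos : 0 < ‖x‖ := lt_of_lt_of_le (by positivity) hxlow
    have hst : Real.sqrt (-t) < 5 * ρ / 16 := by
      rw [Real.sqrt_lt' (by positivity)]
      rw [hτ] at ht1
      linarith
    have h2 : 2 * Real.sqrt (-t) ≤ ‖x‖ := by linarith
    rw [spiralField_of_two_sqrt_le α ht2 h2, enorm_smul, ← ofReal_norm, ← ofReal_norm, norm_rotZ,
      norm_e1, ENNReal.ofReal_one, mul_one, Real.norm_of_nonneg (inv_nonneg.2 (norm_nonneg _)),
      show ((N : ℝ≥0) : ℝ≥0∞) = ENNReal.ofReal (N : ℝ) by simp,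
      ENNReal.ofReal_lt_ofReal_iff (inv_pos.2 hxpos)]
    have hxlt : ‖x‖ < 1 / ((N : ℝ) + 1) := by
      calc ‖x‖ ≤ 7 * ρ / 8 := hxup
        _ < ρ := by linarith
        _ ≤ 1 / ((N : ℝ) + 1) := hρN
    calc (N : ℝ) < (N : ℝ) + 1 := by linarith
      _ ≤ ‖x‖⁻¹ := by
          rw [le_inv_comm₀ (by positivity) hxpos, inv_eq_one_div]
          exact hxlt.le


/-- On the region where the cut-off is off, rotating by `π` flips the field:
`(conjZ π u − u)(t, x) = −(2‖x‖⁻¹) • R(−2α log‖x‖) e₁`. [folklore] -/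
theorem conjZ_pi_sub_spiralField (α : ℝ) {t : ℝ} (ht : t < 0) {x : (EuclideanSpace ℝ (Fin 3))}
    (hx : 2 * Real.sqrt (-t) ≤ ‖x‖) :
    conjZ Real.pi (spiralField α) t x - spiralField α t x =
      -((2 * ‖x‖⁻¹) • rotZ (-(2 * α * Real.log ‖x‖)) e1) := by
  have hx' : 2 * Real.sqrt (-t) ≤ ‖rotZ (-Real.pi) x‖ := by rwa [norm_rotZ]
  simp only [conjZ]
  rw [spiralField_of_two_sqrt_le α ht hx', spiralField_of_two_sqrt_le α ht hx, norm_rotZ, rotZ_smul',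
    rotZ_pi_rotZ_e1, smul_neg, mul_smul, two_smul]
  abel

/-- Its norm there is `2/‖x‖`. [folklore] -/
theorem norm_conjZ_pi_sub_spiralField (α : ℝ) {t : ℝ} (ht : t < 0) {x : (EuclideanSpace ℝ (Fin 3))}
    (hx : 2 * Real.sqrt (-t) ≤ ‖x‖) :
    ‖conjZ Real.pi (spiralField α) t x - spiralField α t x‖ = 2 * ‖x‖⁻¹ := by
  rw [conjZ_pi_sub_spiralField α ht hx, norm_neg, norm_smul, norm_rotZ, norm_e1, mul_one,
    Real.norm_of_nonneg (by positivity)]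

/-- **The kinematic spiral field has NO axisymmetric scar**: for `θ = π` and `K = B̄(2e₁, 1/2)`
the scar difference is `2/‖x‖ ≥ 8/9` on `(−δ, 0) × B(2e₁, 1/4)` for every `δ < 1/2`, so it does
not tend to `0`. [folklore] -/
theorem not_axiScar_spiralField (α : ℝ) : ¬ AxiScar (spiralField α) := by
  intro hA
  set x₀ : (EuclideanSpace ℝ (Fin 3)) := (2 : ℝ) • e1 with hx₀
  have hnx₀ : ‖x₀‖ = 2 := by
    rw [hx₀, norm_smul, norm_e1, mul_one, Real.norm_of_nonneg (by norm_num)]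
  have hK : IsCompact (closedBall x₀ (1 / 2)) := isCompact_closedBall _ _
  have h0 : (0 : (EuclideanSpace ℝ (Fin 3))) ∉ closedBall x₀ (1 / 2) := by
    rw [mem_closedBall, dist_comm, dist_zero_right, hnx₀]
    norm_num
  have hT := hA Real.pi (closedBall x₀ (1 / 2)) hK h0
  set c : ℝ≥0∞ := ENNReal.ofReal (8 / 9) with hc
  have hcpos : (0 : ℝ≥0∞) < c := by rw [hc]; exact ENNReal.ofReal_pos.2 (by norm_num)
  have hev : ∀ᶠ δ in 𝓝[>] (0 : ℝ), eLpNorm (uncurry (conjZ Real.pi (spiralField α)) -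
      uncurry (spiralField α)) ⊤ (volume.restrict (Ioo (-δ) 0 ×ˢ closedBall x₀ (1 / 2))) < c :=
    hT (Iio_mem_nhds hcpos)
  have hev2 : ∀ᶠ δ in 𝓝[>] (0 : ℝ), δ ∈ Ioo (0 : ℝ) (1 / 2) := Ioo_mem_nhdsGT (by norm_num)
  obtain ⟨δ, hlt, hδ0, hδ⟩ := (hev.and hev2).exists
  -- the lower bound `c ≤ ess sup` on `(−δ, 0) × B(x₀, 1/4)`
  refine absurd hlt (not_lt.2 ?_)
  rw [eLpNorm_exponent_top]
  by_contra hlt'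
  push Not at hlt'
  have hae := ae_lt_of_essSup_lt hlt'
  rw [ae_iff] at hae
  set S : Set (ℝ × (EuclideanSpace ℝ (Fin 3))) := Ioo (-δ) 0 ×ˢ ball x₀ (1 / 4) with hS
  have hSsub : S ⊆ Ioo (-δ) 0 ×ˢ closedBall x₀ (1 / 2) :=
    prod_mono Subset.rfl (ball_subset_closedBall.trans (closedBall_subset_closedBall (by norm_num)))
  have hSpos : (volume.restrict (Ioo (-δ) (0 : ℝ) ×ˢ closedBall x₀ (1 / 2))) S ≠ 0 := by
    rw [Measure.restrict_apply (measurableSet_Ioo.prod measurableSet_ball), inter_eq_left.2 hSsub,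
      hS, Measure.volume_eq_prod, Measure.prod_prod]
    refine mul_ne_zero ?_ (measure_ball_pos volume x₀ (by norm_num)).ne'
    rw [Real.volume_Ioo]
    simp [hδ0]
  refine hSpos (measure_mono_null (fun z hz => ?_) hae)
  obtain ⟨⟨ht1, ht2⟩, hx⟩ := hz
  simp only [mem_setOf_eq, not_lt]
  -- on `S`: `‖x‖ ∈ [7/4, 9/4]` and `2√−t < 7/4`
  have hxx : ‖z.2 - x₀‖ < 1 / 4 := by rwa [mem_ball, dist_eq_norm] at hx
  have hxlow : 7 / 4 ≤ ‖z.2‖ := by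
    have : ‖x₀‖ ≤ ‖z.2‖ + ‖z.2 - x₀‖ := by
      calc ‖x₀‖ = ‖z.2 - (z.2 - x₀)‖ := by rw [sub_sub_cancel]
        _ ≤ ‖z.2‖ + ‖z.2 - x₀‖ := norm_sub_le _ _
    rw [hnx₀] at this
    linarith
  have hxup : ‖z.2‖ ≤ 9 / 4 := by
    calc ‖z.2‖ = ‖(z.2 - x₀) + x₀‖ := by rw [sub_add_cancel]
      _ ≤ ‖z.2 - x₀‖ + ‖x₀‖ := norm_add_le _ _
      _ ≤ 9 / 4 := by rw [hnx₀]; linarith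
  have hxpos : 0 < ‖z.2‖ := lt_of_lt_of_le (by norm_num) hxlow
  have ht : z.1 < 0 := ht2
  have hst : Real.sqrt (-z.1) < 7 / 8 := by
    rw [Real.sqrt_lt' (by norm_num)]
    linarith
  have h2 : 2 * Real.sqrt (-z.1) ≤ ‖z.2‖ := by linarith
  show c ≤ ‖conjZ Real.pi (spiralField α) z.1 z.2 - spiralField α z.1 z.2‖ₑ
  rw [← ofReal_norm, norm_conjZ_pi_sub_spiralField α ht h2, hc]
  refine ENNReal.ofReal_le_ofReal ?_
  rw [mul_comm, ← div_eq_inv_mul, le_div_iff₀ hxpos]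
  linarith

/-- … hence NO homogeneous scar either (`homScar_iff_axiScar_of_isSpiralRSS`). [folklore] -/
theorem not_homScar_spiralField {α : ℝ} (hα : α ≠ 0) : ¬ HomScar (spiralField α) := fun h =>
  not_axiScar_spiralField α ((homScar_iff_axiScar_of_isSpiralRSS hα (isSpiralRSS_spiralField hα)).1 h)

/-- **Summary of §5 — the crux's dichotomy is incomplete at the kinematic level.**  For every
`α ≠ 0` there is an explicit field in the Type-I envelope class (space–time bound, backward-singular
origin) which is `α`-RSS, has a spiral scar, and has NEITHER a homogeneous NOR an axisymmetric scar.
Contrast gen 1 (the envelope `C e₃/(‖x‖+√−t)` has both): the only thing standing between this shape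
and a refutation of the crux is the Navier–Stokes system, i.e. the (open) emptiness of the Type-I
RSS class with non-equivariant pattern (Pineau–Vicol 2026 Conj. 1.1).
[cite: PineauVicol2026, Conjecture 1.1 (arXiv:2607.09619 p. 3)] -/
theorem exists_kinematic_spiral_counterexample {α : ℝ} (hα : α ≠ 0) :
    ∃ u : ℝ → (EuclideanSpace ℝ (Fin 3)) → (EuclideanSpace ℝ (Fin 3)), HasTypeIDecay 2 u ∧ IsBackwardSingularPoint u 0 ∧ IsSpiralRSS α u ∧
      SpiralScar α u ∧ ¬ HomScar u ∧ ¬ AxiScar u :=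
  ⟨spiralField α, hasTypeIDecay_spiralField α, isBackwardSingularPoint_spiralField α,
    isSpiralRSS_spiralField hα, spiralScar_spiralField hα, not_homScar_spiralField hα,
    not_axiScar_spiralField α⟩

end Kinematic

end Summit.NavierStokesRegularity.NavierStokesRegularity.Theorems.SymmetricScarExists.Negative
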